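import Literature.IUT.HodgeArakelov.LabelClassesOfCusps

/-!
# [IUTchII] Cor 2.4: the printed family `□ ∈ {•t, ▶}` (`Cor24_family`) and the repaired typing `Cor24_i'` (repair file R3)

Third repair file for the LANDED, frozen `LabelClassesOfCusps.lean` (p407174; abc-iut-L6-t1), after
`LabelClassesOfCuspsR.lean` (abc-iut-L6-d1, p408486: `Cor24_ii_iii'`) and `LabelClassesOfCuspsR2.lean` (abc-iut-L6-t19,
p408509: `Def23_ii'`, `Rmk241_openOrTrivial'`).  REPAIR OF RECORD for node `IUTchII:Cor2.4(i)` under abc-iut-L6-lead's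
ruling §F v1.8 (4), 2026-08-25T23:30:43Z, on finding F-w4d012-1 (abc-iut-w4-d012; classification of abc-iut-L6-t19
23:25:54Z adopted: "predicate with an unpinned parameter", not a false closed fact).  Writer abc-iut-w4-d012.  Two
definitions, no theorem; the landed modules are not edited and no landed decl is restated.

S. Mochizuki, *Inter-universal Teichmüller theory II*, kurims manuscript (Dec. 2020), §2, Corollary 2.4, p. 69 l. −8:
"In the notation of Definition 2.3: Let `t ∈ LabCusp^±(Π_v)`; `□ ∈ {•t, ▶}`."  and (i), pp. 69–70: "Let `I_t ⊆ Π_v` be a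
cuspidal inertia group that belongs to the class determined by `t` such that `I_t ⊆ Δ_{v□}`. … Then for `γ, γ' ∈ Δ̂^±_v`,
the following three conditions are equivalent: (a) `γ' ∈ Δ^±_{v□}`; (b) `I^{γ·γ'}_t ⊆ Π^γ_{v□}`; (c)
`I^{γ·γ'}_t ⊆ (Π^±_{v□})^γ`."

WHY.  The landed `Cor24_i W C H I` (and likewise `Cor24_indices W H`, `Cor24_ii_iii' W C H`) is a PREDICATE in the
subgroup `H = Π_{v□} ⊆ Π_v`, and no decl in the tree pinned the printed instantiation `Π_{v□} ∈ {Π_{v•t}, Π_{v▶}}`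
(`Π_{v•t}` = `LabelledDecomposition.Pbt t`, Def. 2.3 (iv) p. 68; `Π_{v▶}` = `SubgraphDecomposition.Ptri`, Prop. 2.2 p. 66).
At other `H` the predicate `Cor24_i` FAILS whenever `Δ_v ⊆ N_{Π^±_v}(H) ⊆ Π_v` and `Δ_v ≠ Δ^±_v` — kernel record
`not_cor24_i_of_pmBox_le_piV` (`LabelClassesOfCuspsCor24iProofs.lean`, p411807, parametric over the tower): then (c) holds
for every `γ' ∈ Δ^±_v` and (a) fails off `Δ_v`; at the intended model such `H` = open normal subgroups of `Π_v` through
`I_t` not stabilised by the order-`l` outer action of `Gal(X̲̲_v/X_v)` are expected but not constructed in the tree (see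
the note in that theorem's docstring; REVISION 2026-08-26: an earlier illustration by a Kummer character with residues
"along the `Gal(X̲̲_v/X_v)`-orbit of cusps" is withdrawn — `X̲̲_v → X_v` is totally ramified at the cusps, [IUTchI]
Def. 3.1 (e), [IUTchII] Rmk. 2.3.1).  Independently of the model, print binds `□ ∈ {•t, ▶}` and the typing must pin it.
This file pins the family:

* `Cor24_family Dec Ld H` — "`□ ∈ {•t, ▶}`": `H = Π_{v▶}`, or `H = Π_{v•t}` for `t` the label class of some cuspidal
  inertia group `I ⊆ Π_v` (i.e. for some `t ∈ LabCusp^±(Π_v)`, every class having such a representative by the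
  definition of `LabCuspPM` as a quotient of `{I // IsCuspidalInertia Π_v I}`).  This is the admissible-`H` hypothesis
  under which consumers cite the landed predicates `Cor24_indices W H` (p407174) and `Cor24_ii_iii' W C H` (p408486) —
  those decls are NOT restated;
* `Cor24_i' Dec W C Ld I` — Cor. 2.4 (i) for the printed family: the landed predicate `Cor24_i W C H I` (re-used
  verbatim) for every `H` with `Cor24_family Dec Ld H`.  (For `H = Π_{v•t'}` with `t'` not the class of `I`, the
  hypothesis "`I ⊆ Δ_{v•t'}`" inside `Cor24_i` fails at the model — the cusp of `I` does not abut the vertex `t'`,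
  [IUTchI] Cor. 2.3 (vi) — so those instances are vacuous there, as in print, where `□ = •t` carries the label of `I_t`.)

Proof companions: `LabelClassesOfCuspsCor24iProofs.lean` (p411807: (a) ⟹ (b) ⟹ (c) PROVED for every `H`; `Cor24_i`
⇔ ((c) ⟹ (a) at `γ = 1`); `Cor24_i` DISCHARGED MODULO the three printed [IUTchI] §2 inputs Cor. 2.5 / Cor. 2.3 (vi) /
Cor. 2.3 (v) stated inline; the negative above) and, once this file is built, `…Cor24iProofs2.lean`
(`cor24_i'_of_inputs`).  Claim key `Mochizuki2012`, status DISPUTED (D-0012): typing only; nothing here takes a side on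
[IUTchIII] Cor. 3.12 (typed ≠ discharged).
-/

namespace Literature.IUT.HodgeArakelov

universe u

variable {S : BadPlaceSetting.{u}} {P : TopGroup.{u}} {T : TemperedCoverings S P}
  {D : EtaleThetaData S.toThetaSetting P}

/-- **IUTchII:Cor2.4** (kurims p. 69 l. −8) "Let `t ∈ LabCusp^±(Π_v)`; `□ ∈ {•t, ▶}`": the ADMISSIBLE subgroups
`Π_{v□} ⊆ Π_v` of Corollary 2.4 — `Π_{v▶}` (the decomposition group of the subgraph `Γ▶_X`, Prop. 2.2 p. 66; typed
`SubgraphDecomposition.Ptri`) or `Π_{v•t}` for a label class `t ∈ LabCusp^±(Π_v)` (Def. 2.3 (iv) p. 68: "`t` determines a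
unique vertex of `Γ▶_X` … a decomposition group `Π_{v•t} ⊆ Π_{v▶} ⊆ Π_v`"; typed `LabelledDecomposition.Pbt t`), `t`
written as the class of a cuspidal inertia group `I ⊆ Π_v` (Def. 2.3 (iii): `LabCusp^±(Π_v)` is the quotient of the
cuspidal inertia subgroups of `Π_v`).  The hypothesis under which the landed predicates `Cor24_indices W H`,
`Cor24_i W C H I`, `Cor24_ii_iii' W C H` are instantiated as in print.
[claim: Mochizuki2012, status: disputed] (IUTchII §2 Cor 2.4, kurims p.69) -/
def Cor24_family (Dec : SubgraphDecomposition S T D) {W : PlusMinusTower T} {C : CuspidalInertiaData W}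
    {L : LabCuspStructure C} (Ld : LabelledDecomposition Dec L) (H : Subgroup P) : Prop :=
  H = Dec.Ptri ∨
    ∃ (I : Subgroup W.Corhat) (hI : C.IsCuspidalInertia W.piV I),
      H = Ld.Pbt (Quot.mk (labelRel C W.piV W.piPM) ⟨I, hI⟩)

/-- **IUTchII:Cor2.4(i)′** (kurims pp. 69–70) "(Inclusions and Conjugates)", REPAIRED typing = the landed predicate
`Cor24_i W C H I` (p407174, re-used verbatim: "`I_t ⊆ Π_v` a cuspidal inertia group … such that `I_t ⊆ Δ_{v□}` … for
`γ, γ' ∈ Δ̂^±_v`: (a) `γ' ∈ Δ^±_{v□}` ⟺ (b) `I^{γ·γ'}_t ⊆ Π^γ_{v□}` ⟺ (c) `I^{γ·γ'}_t ⊆ (Π^±_{v□})^γ`") for every `Π_{v□}` of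
the PRINTED family "`□ ∈ {•t, ▶}`" (`Cor24_family`).  Decl of record for node `IUTchII:Cor2.4(i)` (abc-iut-L6-lead §F v1.8
(4), 2026-08-25T23:30:43Z); the un-pinned `Cor24_i` fails at every `H` off the family with `Δ_v ⊆ N_{Π^±_v}(H) ⊆ Π_v`
once `Δ_v ≠ Δ^±_v` (`not_cor24_i_of_pmBox_le_piV`, p411807; such `H` are expected at the intended model, see the WHY
paragraph above).  Named statement, not asserted: (c) ⟹ (a) is the content of [IUTchI]
Cor. 2.5 and Cor. 2.3 (v), (vi) (printed proof pp. 70–71), hypotheses of `cor24_i_of_inputs`, not proved in the tree.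
[claim: Mochizuki2012, status: disputed] (IUTchII §2 Cor 2.4 (i), kurims pp.69-70) -/
def Cor24_i' (Dec : SubgraphDecomposition S T D) (W : PlusMinusTower T) (C : CuspidalInertiaData W)
    {L : LabCuspStructure C} (Ld : LabelledDecomposition Dec L) (I : Subgroup W.Corhat) : Prop :=
  ∀ H : Subgroup P, Cor24_family Dec Ld H → Cor24_i W C H I

end Literature.IUT.HodgeArakelov
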